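import Mathlib.LinearAlgebra.BilinearForm.Properties
import Mathlib.Data.Int.Order.Units
import Literature.AlgebraicGeometry.Motives.MumfordTateInvariantsTensorForm
import Literature.AlgebraicGeometry.Motives.MumfordTateInvariantsOrthonormalBasis
import HarnessLib

/-!
# The inverse polarization form on `V^∨` (Mumford–Tate invariants, step 15)

For a polarization `Q` of a pure `ℚ`-Hodge structure `H` of weight `n` on a finite-dimensional `V`:
`Q` is nondegenerate (`Polarization.nondegenerate`, tree), so it defines `θ = Q♭ : V ≃ V^∨`
(`Polarization.toDualEquiv`, Mathlib `LinearMap.BilinForm.toDual`) and the **inverse form**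
`Q^∨(φ, ψ) = Q(θ⁻¹ φ, θ⁻¹ ψ)` on `V^∨` (`Polarization.dualForm`). We prove:

* `Polarization.dualForm_comp_symm` — a similitude `g` of `Q` (`Q(gv, gw) = χ Q(v, w)`, `χ ≠ 0`)
  acts on `V^∨` (contragrediently) as a similitude of `Q^∨` with multiplier `χ⁻¹`;
* the complexification `Q^∨_ℂ = dualFormBaseChange V Q^∨` is the inverse form of `Q_ℂ`
  (`Polarization.dualFormC_eq`), and in an `h`-orthonormal graded basis `e` of `V_ℂ`
  (`Polarization.exists_orthonormal_graded_basis`):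
  `Q^∨_ℂ(e^∨ σ, ē^∨ τ) = δ_{στ} (i^{deg σ}/i^{n-deg σ})` (`ē^∨ = conjDual e^∨` the conjugate
  functional) and `Q^∨_ℂ(e^∨ σ, e^∨ τ) = 0` unless `deg σ + deg τ = n`. In words: `Q^∨` is a
  polarization of the dual Hodge structure `H^∨` (weight `-n`), written in coordinates (Deligne,
  *Théorie de Hodge II*, 1.1.7, 2.1.15).

## References

* P. Deligne, *Théorie de Hodge II*, Publ. Math. IHÉS 40 (1971), 1.1.7, 2.1.15.
* C. Voisin, *Hodge Theory and Complex Algebraic Geometry I* (2002), §7.1.2.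
-/

noncomputable section

open scoped TensorProduct

namespace Literature.AlgebraicGeometry.Motives

namespace HodgeStructure

universe u

variable {V : Type u} [AddCommGroup V] [Module ℚ V] [Module.Finite ℚ V] {n : ℤ}
  {H : HodgeStructure V n}

/-! ### `θ = Q♭` and the inverse form over `ℚ` -/

/-- `θ = Q♭ : V ≃ V^∨`, `v ↦ Q(v, ·)` (`Q` nondegenerate). [folklore] -/
def Polarization.toDualEquiv (Q : Polarization H) : V ≃ₗ[ℚ] Module.Dual ℚ V :=
  Q.form.toDual Q.nondegenerate

/-- `θ v = Q(v, ·)`. [folklore] -/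
@[simp]
theorem Polarization.toDualEquiv_apply (Q : Polarization H) (v w : V) :
    Q.toDualEquiv v w = Q.form v w :=
  LinearMap.BilinForm.toDual_def _

/-- `Q(θ⁻¹ φ, w) = φ w`. [folklore] -/
@[simp]
theorem Polarization.form_toDualEquiv_symm (Q : Polarization H) (φ : Module.Dual ℚ V) (w : V) :
    Q.form (Q.toDualEquiv.symm φ) w = φ w :=
  LinearMap.BilinForm.apply_toDual_symm_apply _ _

/-- **The inverse form** `Q^∨(φ, ψ) = Q(θ⁻¹ φ, θ⁻¹ ψ)` on `V^∨`. [folklore] -/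
def Polarization.dualForm (Q : Polarization H) : LinearMap.BilinForm ℚ (Module.Dual ℚ V) :=
  Q.form.comp Q.toDualEquiv.symm.toLinearMap Q.toDualEquiv.symm.toLinearMap

/-- `Q^∨(φ, ψ) = Q(θ⁻¹ φ, θ⁻¹ ψ)`. [folklore] -/
theorem Polarization.dualForm_apply (Q : Polarization H) (φ ψ : Module.Dual ℚ V) :
    Q.dualForm φ ψ = Q.form (Q.toDualEquiv.symm φ) (Q.toDualEquiv.symm ψ) :=
  rfl

/-- For a similitude `g` of `Q` with multiplier `χ ≠ 0`: `θ⁻¹ (φ ∘ g⁻¹) = χ⁻¹ g (θ⁻¹ φ)`.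
[folklore] -/
theorem Polarization.toDualEquiv_symm_comp_symm (Q : Polarization H) (g : V ≃ₗ[ℚ] V) {χ : ℚ}
    (hχ : χ ≠ 0) (hg : ∀ v w, Q.form (g v) (g w) = χ * Q.form v w) (φ : Module.Dual ℚ V) :
    Q.toDualEquiv.symm (φ ∘ₗ (g.symm : V →ₗ[ℚ] V)) = χ⁻¹ • g (Q.toDualEquiv.symm φ) := by
  apply Q.toDualEquiv.injective
  rw [LinearEquiv.apply_symm_apply]
  ext w
  rw [map_smul, LinearMap.smul_apply, Q.toDualEquiv_apply, LinearMap.comp_apply,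
    LinearEquiv.coe_coe, smul_eq_mul]
  have h := hg (Q.toDualEquiv.symm φ) (g.symm w)
  rw [LinearEquiv.apply_symm_apply, Q.form_toDualEquiv_symm] at h
  rw [h, ← mul_assoc, inv_mul_cancel₀ hχ, one_mul]

/-- **A similitude of `Q` is (contragrediently) a similitude of `Q^∨` with inverse multiplier.**
[folklore] -/
theorem Polarization.dualForm_comp_symm (Q : Polarization H) (g : V ≃ₗ[ℚ] V) {χ : ℚ}
    (hχ : χ ≠ 0) (hg : ∀ v w, Q.form (g v) (g w) = χ * Q.form v w) (φ ψ : Module.Dual ℚ V) :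
    Q.dualForm (φ ∘ₗ (g.symm : V →ₗ[ℚ] V)) (ψ ∘ₗ (g.symm : V →ₗ[ℚ] V)) =
      χ⁻¹ * Q.dualForm φ ψ := by
  rw [Q.dualForm_apply, Q.dualForm_apply, Q.toDualEquiv_symm_comp_symm g hχ hg,
    Q.toDualEquiv_symm_comp_symm g hχ hg]
  simp only [map_smul, LinearMap.smul_apply, smul_eq_mul, hg]
  field_simp

/-! ### Complexification: `Q_ℂ♭` and `Q^∨_ℂ` -/

omit [Module.Finite ℚ V] in
/-- `Q_ℂ` is nondegenerate (both Hodge–Riemann relations; tree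
`Polarization.eq_zero_of_forall_form_eq_zero`). [folklore] -/
theorem Polarization.nondegenerate_baseChange (Q : Polarization H) :
    (Q.form.baseChange ℂ).Nondegenerate :=
  ⟨fun _ hx => Q.eq_zero_of_forall_form_eq_zero hx,
    fun _ hy => Q.eq_zero_of_forall_form_eq_zero' hy⟩

/-- `θ_ℂ = Q_ℂ♭ : V_ℂ ≃ (V_ℂ)^∨`. [folklore] -/
def Polarization.toDualEquivC (Q : Polarization H) :
    (ℂ ⊗[ℚ] V) ≃ₗ[ℂ] Module.Dual ℂ (ℂ ⊗[ℚ] V) :=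
  (Q.form.baseChange ℂ).toDual Q.nondegenerate_baseChange

/-- `θ_ℂ x = Q_ℂ(x, ·)`. [folklore] -/
@[simp]
theorem Polarization.toDualEquivC_apply (Q : Polarization H) (x y : ℂ ⊗[ℚ] V) :
    Q.toDualEquivC x y = Q.form.baseChange ℂ x y :=
  LinearMap.BilinForm.toDual_def _

/-- `Q_ℂ(θ_ℂ⁻¹ α, y) = α y`. [folklore] -/
@[simp]
theorem Polarization.form_toDualEquivC_symm (Q : Polarization H) (α : Module.Dual ℂ (ℂ ⊗[ℚ] V))
    (y : ℂ ⊗[ℚ] V) : Q.form.baseChange ℂ (Q.toDualEquivC.symm α) y = α y :=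
  LinearMap.BilinForm.apply_toDual_symm_apply _ _

/-- `θ_ℂ (1 ⊗ v) = (θ v)_ℂ`. [folklore] -/
theorem Polarization.toDualEquivC_one_tmul (Q : Polarization H) (v : V) :
    Q.toDualEquivC ((1 : ℂ) ⊗ₜ[ℚ] v) = Module.Dual.baseChange ℂ (Q.toDualEquiv v) := by
  refine LinearMap.ext fun z => ?_
  induction z using TensorProduct.induction_on with
  | zero => simp
  | tmul c w =>
    rw [Q.toDualEquivC_apply, LinearMap.BilinForm.baseChange_tmul,
      Module.Dual.baseChange_apply_tmul, Q.toDualEquiv_apply, one_mul]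
  | add x y hx hy => rw [map_add, map_add, hx, hy]

/-- `θ_ℂ⁻¹ (φ_ℂ) = 1 ⊗ θ⁻¹ φ`. [folklore] -/
theorem Polarization.toDualEquivC_symm_baseChange (Q : Polarization H) (φ : Module.Dual ℚ V) :
    Q.toDualEquivC.symm (Module.Dual.baseChange ℂ φ) = (1 : ℂ) ⊗ₜ[ℚ] Q.toDualEquiv.symm φ := by
  rw [LinearEquiv.symm_apply_eq, Q.toDualEquivC_one_tmul, LinearEquiv.apply_symm_apply]

/-- **`Q^∨_ℂ` is the inverse form of `Q_ℂ`**: `Q^∨_ℂ(α, β) = Q_ℂ(θ_ℂ⁻¹ α, θ_ℂ⁻¹ β)`. [folklore] -/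
theorem Polarization.dualFormC_eq (Q : Polarization H) (α β : Module.Dual ℂ (ℂ ⊗[ℚ] V)) :
    dualFormBaseChange V Q.dualForm α β =
      Q.form.baseChange ℂ (Q.toDualEquivC.symm α) (Q.toDualEquivC.symm β) := by
  classical
  suffices h : dualFormBaseChange V Q.dualForm = (Q.form.baseChange ℂ).comp
      Q.toDualEquivC.symm.toLinearMap Q.toDualEquivC.symm.toLinearMap from
    LinearMap.congr_fun₂ h α β
  set Bd : Module.Basis (Fin (Module.finrank ℚ V)) ℂ (Module.Dual ℂ (ℂ ⊗[ℚ] V)) :=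
    (Algebra.TensorProduct.basis ℂ (Module.finBasis ℚ V).dualBasis).map (dualBaseChangeEquiv V)
    with hBd
  have hBdi : ∀ i, Bd i = Module.Dual.baseChange ℂ ((Module.finBasis ℚ V).dualBasis i) := by
    intro i
    rw [hBd, Module.Basis.map_apply, Algebra.TensorProduct.basis_apply, dualBaseChangeEquiv_apply,
      dualBaseChange_one_tmul]
  refine LinearMap.BilinForm.ext_basis Bd fun i j => ?_
  rw [hBdi, hBdi, dualFormBaseChange_baseChange, LinearMap.BilinForm.comp_apply,
    LinearEquiv.coe_coe, Q.toDualEquivC_symm_baseChange, Q.toDualEquivC_symm_baseChange,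
    LinearMap.BilinForm.baseChange_tmul, Q.dualForm_apply, mul_one, Algebra.smul_def, mul_one]
  rfl

/-! ### The conjugate functional -/

omit [Module.Finite ℚ V] in
/-- The conjugate `φ̄ = conj ∘ φ ∘ conj` of a `ℂ`-linear functional on `V_ℂ` (again `ℂ`-linear).
[folklore] -/
def conjDual (φ : Module.Dual ℂ (ℂ ⊗[ℚ] V)) : Module.Dual ℂ (ℂ ⊗[ℚ] V) where
  toFun z := starRingEnd ℂ (φ (conj z))
  map_add' x y := by simp [map_add]
  map_smul' c x := by simp [conj_smul, map_smul]

omit [Module.Finite ℚ V] in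
/-- `φ̄ z = conj (φ (conj z))`. [folklore] -/
@[simp]
theorem conjDual_apply (φ : Module.Dual ℂ (ℂ ⊗[ℚ] V)) (z : ℂ ⊗[ℚ] V) :
    conjDual φ z = starRingEnd ℂ (φ (conj z)) :=
  rfl

omit [Module.Finite ℚ V] in
/-- The sign `ε = (-1)^n`, as a complex number, squares to `1`. [folklore] -/
theorem negOnePow_cast_mul_self (n : ℤ) :
    (((n.negOnePow : ℤˣ) : ℤ) : ℂ) * (((n.negOnePow : ℤˣ) : ℤ) : ℂ) = 1 := by
  rw [← Int.cast_mul, ← Units.val_mul, Int.units_mul_self, Units.val_one, Int.cast_one]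

/-! ### `θ_ℂ` and `Q^∨_ℂ` in an `h`-orthonormal graded basis -/

section Orthonormal

variable (Q : Polarization H) {S : Type u} [Fintype S] [DecidableEq S] {deg : S → ℤ}
  (e : Module.Basis S ℂ (ℂ ⊗[ℚ] V))
  (hon : ∀ σ τ, Q.form.baseChange ℂ (e σ) (conj (e τ)) =
    if σ = τ then (hodgeSign n (deg σ))⁻¹ else 0)
include hon

/-- `θ_ℂ (conj (e σ)) = (-1)^n (i^{deg σ}/i^{n-deg σ})⁻¹ · e^∨ σ`. [folklore] -/
theorem Polarization.toDualEquivC_conj_basis (σ : S) :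
    Q.toDualEquivC (conj (e σ)) =
      ((((n.negOnePow : ℤˣ) : ℤ) : ℂ) * (hodgeSign n (deg σ))⁻¹) • e.dualBasis σ := by
  refine e.ext fun τ => ?_
  rw [Q.toDualEquivC_apply, Q.form_baseChange_swap, hon, LinearMap.smul_apply,
    Module.Basis.dualBasis_apply_self, smul_eq_mul]
  by_cases h : τ = σ
  · subst h
    simp
  · rw [if_neg h, if_neg h, mul_zero, mul_zero]

/-- `θ_ℂ⁻¹ (e^∨ σ) = (-1)^n (i^{deg σ}/i^{n-deg σ}) · conj (e σ)`. [folklore] -/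
theorem Polarization.toDualEquivC_symm_dualBasis (σ : S) :
    Q.toDualEquivC.symm (e.dualBasis σ) =
      ((((n.negOnePow : ℤˣ) : ℤ) : ℂ) * hodgeSign n (deg σ)) • conj (e σ) := by
  rw [LinearEquiv.symm_apply_eq, map_smul, Q.toDualEquivC_conj_basis e hon, smul_smul]
  have h : (((n.negOnePow : ℤˣ) : ℤ) : ℂ) * hodgeSign n (deg σ) *
      ((((n.negOnePow : ℤˣ) : ℤ) : ℂ) * (hodgeSign n (deg σ))⁻¹) = 1 := by
    have h1 := negOnePow_cast_mul_self n
    have h2 := mul_inv_cancel₀ (hodgeSign_ne_zero n (deg σ))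
    linear_combination (hodgeSign n (deg σ) * (hodgeSign n (deg σ))⁻¹) * h1 + h2
  rw [h, one_smul]

/-- `θ_ℂ (e τ) = (i^{deg τ}/i^{n-deg τ})⁻¹ · ē^∨ τ` (expand `conj z` in the basis `e`). [folklore] -/
theorem Polarization.toDualEquivC_basis (τ : S) :
    Q.toDualEquivC (e τ) = (hodgeSign n (deg τ))⁻¹ • conjDual (e.dualBasis τ) := by
  refine LinearMap.ext fun z => ?_
  rw [Q.toDualEquivC_apply, LinearMap.smul_apply, conjDual_apply, smul_eq_mul,
    Module.Basis.dualBasis_apply]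
  -- `z = conj (conj z) = Σ_σ conj (r_σ) conj (e σ)` with `r = e.repr (conj z)`
  have hz : z = ∑ σ, starRingEnd ℂ (e.repr (conj z) σ) • conj (e σ) := by
    conv_lhs => rw [← conj_conj z, ← e.sum_repr (conj z)]
    rw [map_sum]
    simp_rw [conj_smul]
  conv_lhs => rw [hz]
  rw [map_sum]
  simp_rw [map_smul, smul_eq_mul, hon]
  rw [Finset.sum_eq_single τ]
  · rw [if_pos rfl, mul_comm]
  · intro σ _ hστ
    rw [if_neg (Ne.symm hστ), mul_zero]
  · intro h
    exact absurd (Finset.mem_univ τ) h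

/-- `θ_ℂ⁻¹ (ē^∨ τ) = (i^{deg τ}/i^{n-deg τ}) · e τ`. [folklore] -/
theorem Polarization.toDualEquivC_symm_conjDual (τ : S) :
    Q.toDualEquivC.symm (conjDual (e.dualBasis τ)) = hodgeSign n (deg τ) • e τ := by
  rw [LinearEquiv.symm_apply_eq, map_smul, Q.toDualEquivC_basis e hon, smul_smul,
    mul_inv_cancel₀ (hodgeSign_ne_zero n (deg τ)), one_smul]

/-- **`Q^∨_ℂ` in the basis `e^∨`, against the conjugate functionals**:
`Q^∨_ℂ(e^∨ σ, ē^∨ τ) = δ_{στ} (i^{deg σ}/i^{n-deg σ})`. [folklore] -/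
theorem Polarization.dualFormC_dualBasis_conjDual (σ τ : S) :
    dualFormBaseChange V Q.dualForm (e.dualBasis σ) (conjDual (e.dualBasis τ)) =
      if σ = τ then hodgeSign n (deg σ) else 0 := by
  rw [Q.dualFormC_eq, Q.toDualEquivC_symm_dualBasis e hon, Q.toDualEquivC_symm_conjDual e hon]
  simp only [map_smul, LinearMap.smul_apply, smul_eq_mul]
  rw [Q.form_baseChange_swap, hon]
  by_cases h : τ = σ
  · subst h
    rw [if_pos rfl, if_pos rfl]
    have h1 := negOnePow_cast_mul_self n
    have h2 := mul_inv_cancel₀ (hodgeSign_ne_zero n (deg τ))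
    linear_combination (hodgeSign n (deg τ) * hodgeSign n (deg τ) * (hodgeSign n (deg τ))⁻¹) * h1 +
      hodgeSign n (deg τ) * h2
  · rw [if_neg h, if_neg (Ne.symm h)]
    ring

omit hon in
/-- **First Hodge–Riemann relation for `Q^∨_ℂ` in the basis `e^∨`**: if `e σ ∈ V^{deg σ, n-deg σ}`
for all `σ` and the basis is `h`-orthonormal, then `Q^∨_ℂ(e^∨ σ, e^∨ τ) = 0` unless
`deg σ + deg τ = n`. [folklore] -/
theorem Polarization.dualFormC_dualBasis_dualBasis
    (hon : ∀ σ τ, Q.form.baseChange ℂ (e σ) (conj (e τ)) =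
      if σ = τ then (hodgeSign n (deg σ))⁻¹ else 0)
    (he : ∀ σ, e σ ∈ H.piece (deg σ) (n - deg σ)) {σ τ : S} (h : deg σ + deg τ ≠ n) :
    dualFormBaseChange V Q.dualForm (e.dualBasis σ) (e.dualBasis τ) = 0 := by
  rw [Q.dualFormC_eq, Q.toDualEquivC_symm_dualBasis e hon, Q.toDualEquivC_symm_dualBasis e hon]
  simp only [map_smul, LinearMap.smul_apply, smul_eq_mul]
  rw [form_baseChange_conj, Q.form_piece_piece h (he σ) (he τ), map_zero, mul_zero, mul_zero]

end Orthonormal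

end HodgeStructure

end Literature.AlgebraicGeometry.Motives

end
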